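import Summits.CriticalPhenomena.Ising3DConformalLimit.Theses.PositivityBegetsConformality
import Summits.CriticalPhenomena.Ising3DConformalLimit.Theses.HyperoctahedralRP
import Summits.CriticalPhenomena.Ising3DConformalLimit.Theorems.PerfectScreeningMoebiusLimitExistsInversionPositive
import Summits.CriticalPhenomena.Ising3DConformalLimit.Theorems.PerfectScreeningMoebiusLimitExistsSketchReduction
import Literature.Probability.LatticeModels.InversionPositivity
import Literature.Probability.LatticeModels.SphereReflectionPositivityDimGeThree
import Literature.Probability.LatticeModels.CriticalScalingDimension
import Summits.CriticalPhenomena.Ising3DConformalLimit.Theorems.InversionUpgradeNormalised.Negative.ScaleZeroDressing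
import Literature.Probability.LatticeModels.CriticalWickDichotomy
import HarnessLib

/-!
# `InversionPositiveLimit` (item stmt-CriticalPhenomena-4671): reductions, proved strata, consequences

Route `PositivityBegetsConformality`, sub-problem `Ising3DConformalLimit`; helper file of the line
`Cruxes/InversionPositiveLimit/Lines/birth.lean` (lead c3), landed `--supports stmt-CriticalPhenomena-4671`.
Theorem-only (no definitions, no `sorry`).

The crux says: every normalised, non-degenerate, translation-invariant, scale-covariant (weight `Δ`)
pointwise scaling limit `S` of `criticalCorr 3` is inversion POSITIVE with weight `Δ`
(`IsInversionPositive Δ S`, unfolded verbatim in the route file).  The tree already holds the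
kernel-checked equivalence crux ⟺ item stmt-1982 `InversionUpgradeNormalised`
(`inversionPositiveLimit_iff_inversionUpgradeNormalised`).  This file records, on the item itself:

* `isInversionPositive_iff_isInversionCovariant_of_limit` — the equivalence INSTANCE-WISE: for each
  admissible limit `S`, inversion positivity ⟺ inversion covariance (Mack's converse over the landed
  plane reflection positivity, isotropy and permutation symmetry of Ising₃ limits; and the symmetry
  half of positivity the other way);
* `inversionPositiveLimit_iff_interiorStrict` — the EXACT RESIDUAL: the crux is equivalent to the
  strict-window interior inversion upgrade (`1/2 < Δ ≤ 3/4`, `HasNontrivialU4`, pointwise OS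
  reconstruction along every axis, clustering along rays ⇒ `IsInversionCovariant Δ S`), the single
  open stub of item 1982's line `free-endpoint-gaussian-closure`;
* two strata of the crux PROVED unconditionally:
  `isInversionPositive_of_limit_of_not_hasNontrivialU4` — the Gaussian locus (`U₄ ≡ 0`) of admissible
  limits is inversion positive (= STUB A `stub_gaussianLocusPositive` of the registered skeleton, by name); `inversionGram_arityOne_posSemidef_of_limit` — the two-point (`1|1`,
  all arities `= 1`) level of the radial OS Gram matrices of EVERY admissible limit is positive
  semidefinite (window `Δ ∈ [1/2,1]` + isotropy + the Neeb–Ólafsson ball kernel at `s = 2Δ ≥ 1`);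
* consequences: `fourPointConeMembership_of_inversionPositiveLimit` (crux ⇒ item stmt-4672, the
  route's rank-3 crux is a special case), and the lattice dictionary — the radial OS quadratic form of
  the rescaled lattice correlators converges to that of the limit (`tendsto_latticeForm`), so the crux
  forces asymptotic lattice radial OS positivity (`latticeRadialPositivity_of_inversionPositiveLimit`,
  the birth certificate's former STUB 2, verbatim signature).
-/

noncomputable section

open Filter Topology
open Literature.Probability.LatticeModels Literature.MathematicalPhysics.QuantumFieldTheory
open EuclideanGeometry

namespace Summit.CriticalPhenomena.Ising3DConformalLimit.PositivityBegetsConformalityInversionPositiveLimit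

open Summit.CriticalPhenomena.Ising3DConformalLimit.Theses
open Summit.CriticalPhenomena.Ising3DConformalLimit.MoebiusLimitExistsInversionPositive
  (isInversionPositive_of_limit inversionPositiveLimit_iff_inversionUpgradeNormalised)
open Summit.CriticalPhenomena.Ising3DConformalLimit.MoebiusLimitExistsSketch
  (inversionUpgradeNormalised_iff_interiorStrict gaussianFamilyInversionCovariant)
open Summit.CriticalPhenomena.Ising3DConformalLimit.MoebiusLimitExistsTwoLeaf
  (isRotationInvariant_of_scaleCovariantLimit)
open Summit.CriticalPhenomena.Ising3DConformalLimit.PositivityBegetsConformalityMoebiusOfInversionPositive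
  (moebiusOfInversionPositive_proof)
open Summit.CriticalPhenomena.Ising3DConformalLimit.InversionUpgradeNormalisedNegative (two_point_eq fin_append_one_one)

/-! ## The crux instance-wise: positivity ⟺ covariance for each admissible limit -/

/-- **Instance-wise Mack equivalence.** For a normalised, non-degenerate, translation-invariant,
scale-covariant pointwise scaling limit `S` of `criticalCorr 3`, inversion POSITIVITY with weight `Δ`
is equivalent to inversion COVARIANCE with weight `Δ`: (⇒) the symmetry half of positivity
(`moebiusOfInversionPositive_proof`, item stmt-4673); (⇐) Mack's converse over the landed plane
reflection positivity, `O(3)` invariance and permutation symmetry of such limits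
(`isInversionPositive_of_limit`). [cite: LuscherMack1975, §2–§3] -/
theorem isInversionPositive_iff_isInversionCovariant_of_limit {ρ : ℝ → ℝ} {Δ : ℝ} {S : CorrFamily 3}
    (hρ : ∀ δ ∈ Set.Ioc (0:ℝ) 1, 0 < ρ δ) (hlim : HasPointwiseScalingLimit (criticalCorr 3) ρ S)
    (hnorm : ∀ n z, z ∉ NonCoincident 3 n → S n z = 0) (hnd : IsNondegenerateTwoPoint S)
    (htr : IsTranslationInvariant S) (hsc : IsScaleCovariant Δ S) :
    IsInversionPositive Δ S ↔ IsInversionCovariant Δ S :=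
  ⟨fun h => (moebiusOfInversionPositive_proof ρ Δ S hρ hlim hnorm hnd htr hsc h).isInversionCovariant,
    fun h => isInversionPositive_of_limit hρ hlim hnorm hnd htr hsc h⟩

/-! ## The exact residual -/

/-- **The crux IS the strict-window interior inversion upgrade**: `InversionPositiveLimit` is
equivalent to the residual stub of item stmt-1982's live line — every admissible, Euclidean-invariant
limit with `1/2 < Δ ≤ 3/4`, `HasNontrivialU4`, pointwise OS reconstruction along the three axes and
clustering along every ray is `IsInversionCovariant Δ`
(`inversionPositiveLimit_iff_inversionUpgradeNormalised` then `inversionUpgradeNormalised_iff_interiorStrict`).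
[folklore] -/
theorem inversionPositiveLimit_iff_interiorStrict :
    PositivityBegetsConformality.InversionPositiveLimit ↔
      (∀ (ρ : ℝ → ℝ) (Δ : ℝ) (S : CorrFamily 3), (∀ δ ∈ Set.Ioc (0:ℝ) 1, 0 < ρ δ) →
        HasPointwiseScalingLimit (criticalCorr 3) ρ S → (∀ n z, z ∉ NonCoincident 3 n → S n z = 0) →
        IsNondegenerateTwoPoint S → IsEuclideanInvariant S → IsScaleCovariant Δ S → 1 / 2 < Δ → Δ ≤ 3 / 4 →
        HasNontrivialU4 S → (∀ τ : Fin 3, PointwiseOSReconstruction τ S) →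
        (∀ (n m : ℕ) (x : Fin n → EuclideanSpace ℝ (Fin 3)) (y : Fin m → EuclideanSpace ℝ (Fin 3))
          (v : EuclideanSpace ℝ (Fin 3)), v ≠ 0 →
          Tendsto (fun t : ℝ => S (n + m) (Fin.append x (fun j => y j + t • v)) - S n x * S m y) atTop (𝓝 0)) →
        IsInversionCovariant Δ S) :=
  inversionPositiveLimit_iff_inversionUpgradeNormalised.trans inversionUpgradeNormalised_iff_interiorStrict

/-! ## Proved stratum 1: the Gaussian locus -/

/-- **The Gaussian locus of the crux is proved.** An admissible limit `S` of `criticalCorr 3` whose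
connected four-point function vanishes identically on non-coincident configurations is inversion
positive with weight `Δ`: odd orders vanish (`HasPointwiseScalingLimit.eq_zero_of_odd`), Wick's rule
holds at all even orders (`eq_pairingSum_of_limitConnectedFour_eq_zero`, Newman's Lee–Yang Gaussian
dichotomy), the Gaussian locus is inversion covariant (`gaussianFamilyInversionCovariant`, with the
isotropy `isRotationInvariant_of_scaleCovariantLimit`), and covariance gives positivity
(`isInversionPositive_of_limit`). [folklore] -/
theorem isInversionPositive_of_limit_of_not_hasNontrivialU4 {ρ : ℝ → ℝ} {Δ : ℝ} {S : CorrFamily 3}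
    (hρ : ∀ δ ∈ Set.Ioc (0:ℝ) 1, 0 < ρ δ) (hlim : HasPointwiseScalingLimit (criticalCorr 3) ρ S)
    (hnorm : ∀ n z, z ∉ NonCoincident 3 n → S n z = 0) (hnd : IsNondegenerateTwoPoint S)
    (htr : IsTranslationInvariant S) (hsc : IsScaleCovariant Δ S) (hU4 : ¬ HasNontrivialU4 S) :
    IsInversionPositive Δ S := by
  have hrot : IsRotationInvariant S := isRotationInvariant_of_scaleCovariantLimit hρ hlim hnorm hnd htr hsc
  have hodd : ∀ n (x : Fin n → EuclideanSpace ℝ (Fin 3)), Odd n → S n x = 0 := by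
    intro n x hn
    by_cases hx : x ∈ NonCoincident 3 n
    · exact hlim.eq_zero_of_odd le_rfl hn hx
    · exact hnorm n x hx
  have hU : ∀ z ∈ NonCoincident 3 4, limitConnectedFour S z = 0 := by
    intro z hz
    by_contra hne
    exact hU4 ⟨z, hz, hne⟩
  have hwick : ∀ n, 2 ≤ n → ∀ x ∈ NonCoincident 3 (2 * n),
      S (2 * n) x = pairingSum (fun p q => S 2 ![p, q]) n x :=
    fun n hn x hx => hlim.eq_pairingSum_of_limitConnectedFour_eq_zero le_rfl hU hn hx
  exact isInversionPositive_of_limit hρ hlim hnorm hnd htr hsc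
    (gaussianFamilyInversionCovariant hnorm ⟨htr, hrot⟩ hsc hodd hwick)

/-- **STUB A of the registered skeleton `Cruxes/InversionPositiveLimit/Lines/birth.lean` (c3 reshape),
by name and signature**: the Gaussian locus of the crux (`isInversionPositive_of_limit_of_not_hasNontrivialU4`).
[folklore] -/
theorem stub_gaussianLocusPositive :
    ∀ (ρ : ℝ → ℝ) (Δ : ℝ) (S : CorrFamily 3), (∀ δ ∈ Set.Ioc (0:ℝ) 1, 0 < ρ δ) →
      HasPointwiseScalingLimit (criticalCorr 3) ρ S → (∀ n z, z ∉ NonCoincident 3 n → S n z = 0) →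
      IsNondegenerateTwoPoint S → IsTranslationInvariant S → IsScaleCovariant Δ S →
      ¬ HasNontrivialU4 S → IsInversionPositive Δ S :=
  fun _ _ _ hρ hlim hnorm hnd htr hsc hU4 =>
    isInversionPositive_of_limit_of_not_hasNontrivialU4 hρ hlim hnorm hnd htr hsc hU4

/-- Hence the crux is equivalent to its restriction to the INTERACTING stratum `HasNontrivialU4 S`.
[folklore] -/
theorem inversionPositiveLimit_iff_interacting :
    PositivityBegetsConformality.InversionPositiveLimit ↔
      (∀ (ρ : ℝ → ℝ) (Δ : ℝ) (S : CorrFamily 3), (∀ δ ∈ Set.Ioc (0:ℝ) 1, 0 < ρ δ) →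
        HasPointwiseScalingLimit (criticalCorr 3) ρ S → (∀ n z, z ∉ NonCoincident 3 n → S n z = 0) →
        IsNondegenerateTwoPoint S → IsTranslationInvariant S → IsScaleCovariant Δ S → HasNontrivialU4 S →
        IsInversionPositive Δ S) := by
  refine ⟨fun h ρ Δ S hρ hlim hnorm hnd htr hsc _ => h ρ Δ S hρ hlim hnorm hnd htr hsc, fun h => ?_⟩
  intro ρ Δ S hρ hlim hnorm hnd htr hsc
  by_cases hU4 : HasNontrivialU4 S
  · exact h ρ Δ S hρ hlim hnorm hnd htr hsc hU4
  · exact isInversionPositive_of_limit_of_not_hasNontrivialU4 hρ hlim hnorm hnd htr hsc hU4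

/-! ## Proved stratum 2: the two-point (`1|1`) level of every admissible limit -/

/-- A point of the open unit ball differs from the inversion of a point of the punctured open unit
ball (`‖x‖ < 1 < ‖ι y‖`). [folklore] -/
theorem ne_inversion_of_norm_lt_one {x y : EuclideanSpace ℝ (Fin 3)} (hx : ‖x‖ < 1) (hy : y ≠ 0)
    (hy1 : ‖y‖ < 1) : x ≠ inversion 0 1 y := by
  intro h
  have h2 : 1 < ‖inversion 0 1 y‖ := one_lt_norm_inversion hy hy1
  rw [← h] at h2
  exact lt_irrefl _ (hx.trans h2)

/-- **The two-point level of the crux is proved.** For EVERY normalised, non-degenerate,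
translation-invariant, scale-covariant pointwise scaling limit `S` of `criticalCorr 3` and every
finite family of one-point configurations `X_a` in the punctured open unit ball, the radial OS Gram
matrix `M_ab = ‖X_b 0‖^(−2Δ) S₂(X_a 0, ιX_b 0)` (the crux's matrix at arities `k ≡ 1`) is positive
semidefinite.  Proof: the limit is `O(3)` invariant (`isRotationInvariant_of_scaleCovariantLimit`,
items 1979/1980), so `S₂(p,q) = A‖p − q‖^(−2Δ)` with `A = S₂(0,e₀) > 0` (`two_point_eq`); the window
theorem `scalingDimension_mem_Icc_holds` (infrared bound + Simon–Lieb) gives `2Δ ≥ 1 = d − 2`; and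
`M = A · R_{2Δ}` with `R_s` the Neeb–Ólafsson ball kernel, positive semidefinite for `s ≥ d − 2`
(`ballKernel_posSemidef_dim_ge_three`). [cite: NeebOlafsson2014, Prop. 6.2 (§6.2, arXiv:1206.2039 p. 23)] -/
theorem inversionGram_arityOne_posSemidef_of_limit {ρ : ℝ → ℝ} {Δ : ℝ} {S : CorrFamily 3}
    (hρ : ∀ δ ∈ Set.Ioc (0:ℝ) 1, 0 < ρ δ) (hlim : HasPointwiseScalingLimit (criticalCorr 3) ρ S)
    (hnorm : ∀ n z, z ∉ NonCoincident 3 n → S n z = 0) (hnd : IsNondegenerateTwoPoint S)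
    (htr : IsTranslationInvariant S) (hsc : IsScaleCovariant Δ S)
    {m : ℕ} (X : Fin m → Fin 1 → EuclideanSpace ℝ (Fin 3)) (hX : ∀ a i, X a i ≠ 0 ∧ ‖X a i‖ < 1) :
    (inversionGram Δ S (fun _ => 1) X).PosSemidef := by
  have hrot : IsRotationInvariant S := isRotationInvariant_of_scaleCovariantLimit hρ hlim hnorm hnd htr hsc
  have heuc : IsEuclideanInvariant S := ⟨htr, hrot⟩
  have hΔ : 1 / 2 ≤ Δ := (scalingDimension_mem_Icc_holds ρ Δ S hlim hsc hnd hρ).1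
  -- the amplitude of the two-point function
  set e₀ : EuclideanSpace ℝ (Fin 3) := EuclideanSpace.single 0 1 with he₀
  set A : ℝ := S 2 ![0, e₀] with hA
  have he₀_ne : (0 : EuclideanSpace ℝ (Fin 3)) ≠ e₀ := by
    intro h
    have h1 : ‖e₀‖ = 1 := by simp [he₀]
    rw [← h, norm_zero] at h1
    exact zero_ne_one h1
  have hA0 : 0 ≤ A := by
    refine (hnd _ ?_).le
    rw [mem_nonCoincident]
    intro i j hij
    fin_cases i <;> fin_cases j
    · rfl
    · exact absurd hij he₀_ne
    · exact absurd hij.symm he₀_ne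
    · rfl
  -- the Neeb–Ólafsson ball kernel matrix at `s = 2Δ ≥ 1 = d - 2`
  have hB : (Matrix.of fun a b : Fin m =>
      (1 - 2 * inner ℝ (X a 0) (X b 0) + ‖X a 0‖ ^ 2 * ‖X b 0‖ ^ 2) ^ (-(2 * Δ) / 2)).PosSemidef :=
    ballKernel_posSemidef_dim_ge_three (n := 3) le_rfl (s := 2 * Δ) (by norm_num; linarith)
      (fun a => X a 0) (fun a => (hX a 0).2)
  -- entrywise identification `M = A • R_{2Δ}`
  have hM : inversionGram Δ S (fun _ => 1) X =
      A • (Matrix.of fun a b : Fin m =>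
        (1 - 2 * inner ℝ (X a 0) (X b 0) + ‖X a 0‖ ^ 2 * ‖X b 0‖ ^ 2) ^ (-(2 * Δ) / 2)) := by
    ext a b
    rw [inversionGram_apply, Matrix.smul_apply, Matrix.of_apply, smul_eq_mul, Fin.prod_univ_one,
      fin_append_one_one, ← ballKernel_apply, ← ballKernel_eq_inversion_form (2 * Δ) (X a 0) (hX b 0).1,
      two_point_eq heuc hsc (ne_inversion_of_norm_lt_one (hX a 0).2 (hX b 0).1 (hX b 0).2)]
    ring
  rw [hM]
  exact hB.smul hA0

/-- The same statement in the route's raw spelling (the crux's matrix family at `k ≡ 1`). [folklore] -/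
theorem arityOne_posSemidef_of_limit {ρ : ℝ → ℝ} {Δ : ℝ} {S : CorrFamily 3}
    (hρ : ∀ δ ∈ Set.Ioc (0:ℝ) 1, 0 < ρ δ) (hlim : HasPointwiseScalingLimit (criticalCorr 3) ρ S)
    (hnorm : ∀ n z, z ∉ NonCoincident 3 n → S n z = 0) (hnd : IsNondegenerateTwoPoint S)
    (htr : IsTranslationInvariant S) (hsc : IsScaleCovariant Δ S)
    {m : ℕ} (X : Fin m → Fin 1 → EuclideanSpace ℝ (Fin 3)) (hX : ∀ a i, X a i ≠ 0 ∧ ‖X a i‖ < 1) :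
    (Matrix.of fun a b : Fin m => (∏ i, ‖X b i‖ ^ (-(2 * Δ))) *
      S (1 + 1) (Fin.append (X a) (fun i => inversion 0 1 (X b i)))).PosSemidef :=
  inversionGram_arityOne_posSemidef_of_limit hρ hlim hnorm hnd htr hsc X hX

/-! ## Consequence 1: the route's rank-3 crux is a special case -/

/-- A pair with distinct entries is an injective configuration. [folklore] -/
theorem injective_of_apply_zero_ne_one {α : Type*} {f : Fin 2 → α} (h : f 0 ≠ f 1) :
    Function.Injective f := by
  intro i j hij
  fin_cases i <;> fin_cases j
  · rfl
  · exact absurd hij h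
  · exact absurd hij.symm h
  · rfl

/-- **Crux ⇒ `FourPointConeMembership` (item stmt-4672)**: the `2|2` block of the four-point
function is the crux's matrix family at arities `k ≡ 2`. [folklore] -/
theorem fourPointConeMembership_of_inversionPositiveLimit
    (h : PositivityBegetsConformality.InversionPositiveLimit) :
    PositivityBegetsConformality.FourPointConeMembership := by
  intro ρ Δ S hρ hlim hnorm hnd htr hsc m X hX hne
  exact h ρ Δ S hρ hlim hnorm hnd htr hsc m (fun _ => 2) X hX
    (fun a => injective_of_apply_zero_ne_one (hne a))

/-! ## Consequence 2: the lattice dictionary (necessity of lattice radial OS positivity) -/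

/-- **The cone is closed along the mesh filter.** The radial OS quadratic form of the rescaled
lattice correlators converges, as `δ → 0⁺`, to that of the limit `S` (admissible juxtapositions are
non-coincident, `append_inversion_mem_nonCoincident`; finite sums of limits). [folklore] -/
theorem tendsto_latticeForm {ρ : ℝ → ℝ} (Δ : ℝ) {S : CorrFamily 3}
    (hlim : HasPointwiseScalingLimit (criticalCorr 3) ρ S)
    {m : ℕ} {k : Fin m → ℕ} {X : (a : Fin m) → Fin (k a) → EuclideanSpace ℝ (Fin 3)}
    (hX : ∀ a i, X a i ≠ 0 ∧ ‖X a i‖ < 1) (hinj : ∀ a, Function.Injective (X a))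
    (c : Fin m → ℝ) :
    Tendsto (fun δ => ∑ a, ∑ b, c a * c b * ((∏ i, ‖X b i‖ ^ (-(2 * Δ))) *
        rescaledCorrelator (criticalCorr 3) ρ (k a + k b) δ
          (Fin.append (X a) (fun i => inversion 0 1 (X b i)))))
      (𝓝[>] (0:ℝ))
      (𝓝 (∑ a, ∑ b, c a * c b * ((∏ i, ‖X b i‖ ^ (-(2 * Δ))) *
        S (k a + k b) (Fin.append (X a) (fun i => inversion 0 1 (X b i)))))) := by
  refine tendsto_finsetSum _ fun a _ => tendsto_finsetSum _ fun b _ => ?_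
  exact (((hlim (k a + k b)).tendsto_at
    (append_inversion_mem_nonCoincident hX hinj a b)).const_mul _).const_mul _

/-- **Instance-wise necessity.** If an admissible limit `S` is inversion positive, the radial OS
quadratic form of the rescaled LATTICE correlators at any admissible family is eventually `≥ −ε`
as `δ → 0⁺` (the limit form is `≥ 0`, `IsInversionPositive.sum_mul_inversionGram_nonneg`, and the
lattice form converges to it, `tendsto_latticeForm`). [folklore] -/
theorem latticeForm_eventually_ge_of_isInversionPositive {ρ : ℝ → ℝ} {Δ : ℝ} {S : CorrFamily 3}
    (hlim : HasPointwiseScalingLimit (criticalCorr 3) ρ S) (hIP : IsInversionPositive Δ S)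
    {m : ℕ} {k : Fin m → ℕ} {X : (a : Fin m) → Fin (k a) → EuclideanSpace ℝ (Fin 3)}
    (hX : ∀ a i, X a i ≠ 0 ∧ ‖X a i‖ < 1) (hinj : ∀ a, Function.Injective (X a))
    (c : Fin m → ℝ) {ε : ℝ} (hε : 0 < ε) :
    ∀ᶠ δ in 𝓝[>] (0:ℝ),
      -ε ≤ ∑ a, ∑ b, c a * c b * ((∏ i, ‖X b i‖ ^ (-(2 * Δ))) *
        rescaledCorrelator (criticalCorr 3) ρ (k a + k b) δ
          (Fin.append (X a) (fun i => inversion 0 1 (X b i)))) := by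
  have h0 : 0 ≤ ∑ a, ∑ b, c a * c b * ((∏ i, ‖X b i‖ ^ (-(2 * Δ))) *
      S (k a + k b) (Fin.append (X a) (fun i => inversion 0 1 (X b i)))) := by
    simpa only [inversionGram_apply] using hIP.sum_mul_inversionGram_nonneg hX hinj c
  have hev := (tendsto_latticeForm Δ hlim hX hinj c).eventually
    (Ioi_mem_nhds (show (∑ a, ∑ b, c a * c b * ((∏ i, ‖X b i‖ ^ (-(2 * Δ))) *
      S (k a + k b) (Fin.append (X a) (fun i => inversion 0 1 (X b i))))) - ε <
      ∑ a, ∑ b, c a * c b * ((∏ i, ‖X b i‖ ^ (-(2 * Δ))) *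
        S (k a + k b) (Fin.append (X a) (fun i => inversion 0 1 (X b i)))) by linarith))
  filter_upwards [hev] with δ hδ
  linarith

/-- **Crux ⇒ lattice radial OS positivity** (the birth certificate's former STUB 2
`stub_latticeRadialPositivity`, verbatim signature): under the crux, for every admissible limit and
every admissible family, the radial OS quadratic form built from the renormalised critical LATTICE
correlators at spins `[X/δ]`, `[ιX/δ]` is asymptotically non-negative. [folklore] -/
theorem latticeRadialPositivity_of_inversionPositiveLimit
    (h : PositivityBegetsConformality.InversionPositiveLimit) :
    ∀ (ρ : ℝ → ℝ) (Δ : ℝ) (S : Literature.Probability.LatticeModels.CorrFamily 3),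
      (∀ δ ∈ Set.Ioc (0:ℝ) 1, 0 < ρ δ) →
      Literature.Probability.LatticeModels.HasPointwiseScalingLimit
        (Literature.Probability.LatticeModels.criticalCorr 3) ρ S →
      (∀ n z, z ∉ Literature.Probability.LatticeModels.NonCoincident 3 n → S n z = 0) →
      Literature.Probability.LatticeModels.IsNondegenerateTwoPoint S →
      Literature.Probability.LatticeModels.IsTranslationInvariant S →
      Literature.Probability.LatticeModels.IsScaleCovariant Δ S →
      ∀ (m : ℕ) (k : Fin m → ℕ) (X : (a : Fin m) → Fin (k a) → EuclideanSpace ℝ (Fin 3)),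
        (∀ a i, X a i ≠ 0 ∧ ‖X a i‖ < 1) → (∀ a, Function.Injective (X a)) →
        ∀ (c : Fin m → ℝ) (ε : ℝ), 0 < ε →
          ∀ᶠ δ in nhdsWithin (0:ℝ) (Set.Ioi 0),
            -ε ≤ ∑ a, ∑ b, c a * c b * ((∏ i, ‖X b i‖ ^ (-(2 * Δ))) *
              Literature.Probability.LatticeModels.rescaledCorrelator
                (Literature.Probability.LatticeModels.criticalCorr 3) ρ (k a + k b) δ
                (Fin.append (X a) (fun i => EuclideanGeometry.inversion 0 1 (X b i)))) :=
  fun ρ Δ S hρ hlim hnorm hnd htr hsc _ _ _ hX hinj c _ hε =>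
    latticeForm_eventually_ge_of_isInversionPositive hlim (h ρ Δ S hρ hlim hnorm hnd htr hsc) hX hinj c hε

/-- **Unconditional lattice corollary at the two-point level**: for every admissible limit (no
positivity assumed) the `1|1` radial OS form of the renormalised critical lattice two-point function
at spins `[X_a/δ]`, `[ιX_b/δ]` is asymptotically non-negative (`inversionGram_arityOne_posSemidef_of_limit`
+ `tendsto_latticeForm`). [folklore] -/
theorem latticeForm_arityOne_eventually_ge_of_limit {ρ : ℝ → ℝ} {Δ : ℝ} {S : CorrFamily 3}
    (hρ : ∀ δ ∈ Set.Ioc (0:ℝ) 1, 0 < ρ δ) (hlim : HasPointwiseScalingLimit (criticalCorr 3) ρ S)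
    (hnorm : ∀ n z, z ∉ NonCoincident 3 n → S n z = 0) (hnd : IsNondegenerateTwoPoint S)
    (htr : IsTranslationInvariant S) (hsc : IsScaleCovariant Δ S)
    {m : ℕ} (X : Fin m → Fin 1 → EuclideanSpace ℝ (Fin 3)) (hX : ∀ a i, X a i ≠ 0 ∧ ‖X a i‖ < 1)
    (c : Fin m → ℝ) {ε : ℝ} (hε : 0 < ε) :
    ∀ᶠ δ in 𝓝[>] (0:ℝ),
      -ε ≤ ∑ a, ∑ b, c a * c b * ((∏ i, ‖X b i‖ ^ (-(2 * Δ))) *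
        rescaledCorrelator (criticalCorr 3) ρ (1 + 1) δ
          (Fin.append (X a) (fun i => inversion 0 1 (X b i)))) := by
  have hinj : ∀ a, Function.Injective (X a) := fun a i j _ => Subsingleton.elim i j
  have hpsd := inversionGram_arityOne_posSemidef_of_limit hρ hlim hnorm hnd htr hsc X hX
  have h0 : 0 ≤ ∑ a, ∑ b, c a * c b * ((∏ i, ‖X b i‖ ^ (-(2 * Δ))) *
      S (1 + 1) (Fin.append (X a) (fun i => inversion 0 1 (X b i)))) := by
    have h1 := hpsd.dotProduct_mulVec_nonneg c
    simp only [dotProduct, Matrix.mulVec, star_trivial, Finset.mul_sum, inversionGram_apply] at h1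
    refine h1.trans_eq (Finset.sum_congr rfl fun a _ => Finset.sum_congr rfl fun b _ => ?_)
    ring
  have hev := (tendsto_latticeForm (k := fun _ => 1) Δ hlim hX hinj c).eventually
    (Ioi_mem_nhds (show (∑ a, ∑ b, c a * c b * ((∏ i, ‖X b i‖ ^ (-(2 * Δ))) *
      S (1 + 1) (Fin.append (X a) (fun i => inversion 0 1 (X b i))))) - ε <
      ∑ a, ∑ b, c a * c b * ((∏ i, ‖X b i‖ ^ (-(2 * Δ))) *
        S (1 + 1) (Fin.append (X a) (fun i => inversion 0 1 (X b i)))) by linarith))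
  filter_upwards [hev] with δ hδ
  linarith

end Summit.CriticalPhenomena.Ising3DConformalLimit.PositivityBegetsConformalityInversionPositiveLimit

end
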